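import Summits.HodgeConjecture.HodgeConjecture.Theorems.CYFormCasimirCYFormCarrierEightMatrix
import HarnessLib

/-!
# Crux X1 `CYFormCarrierEight` (route `CYFormCasimir`, stmt-HodgeConjecture-23493), helper file 16:
# uniqueness of the duality operators and their `SU_H(ℂ)`-equivariance

research route conditional on HC_CM; not a corollary. Nothing here proves HC, HC_CM, the rung H2, X1 or
`stub_cyform_exists`; steps S2/S3 of `Cruxes/CYFormCarrierEight/STUB-PLAN-stub_cyform_exists.md`.

For a Hodge-general hyperbolic `ℚ(√-d)`-Weil eightfold `(A, φ)` (`Hg = SU_H`; Weil classes of type `(4,4)`), `E₊ = ⋀⁴W`,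
`E₋ = ⋀⁴W^*`, and the duality operators `s₊` (`tr((z ∪ s₊ x) ∪ h_K⁴) = tr((z ∪ x) ∪ v)`, `x, z ∈ E₊`) and `s₋` (data `v'`) of
helper files 14/15 with `v, v'` in the Weil plane `weilClassesOf A φ 4 d`:
* `eq_of_beta_eq_right`, `eq_of_beta'_eq_left` — elements of `E₋` (resp. `E₊`) are determined by their `β`-pairings;
* `extAct_id`, `extAct_apply_symm_apply`, `tri_extAct`, `extAct_mem_weilClassesPlus_two/Minus_two` — bookkeeping for the
  exterior action `⋀•u` of `u ∈ SU_H(ℂ)`: multiplicative, trivial on `H¹⁶`, preserving `E±`;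
* `starPlus_extAct_comm`, `starMinus_extAct_comm` — **`s₊(⋀⁴u x) = ⋀⁴u (s₊ x)` on `E₊` and `s₋(⋀⁴u y) = ⋀⁴u (s₋ y)` on `E₋`
  for every `u ∈ SU_H(ℂ)`**: `⋀•u` fixes `h_K⁴` and the Weil classes `v, v'` (Hodge classes, `Hg = SU_H`) and preserves all the
  pairings, so both sides satisfy the same defining identity (uniqueness).

References: FriedmanLaza2013 (§3.5 Lemma 36: `⋆` is `SU`-equivariant), vanGeemen1994HodgeAV (6.4–6.7, Lemma 6.10, Thm. 6.12).
-/

-- `Summit.HodgeConjecture.HodgeConjecture.…` is the tree's mandated summit/problem namespace (single-problem summit).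
set_option linter.dupNamespace false
noncomputable section

open CategoryTheory
open Literature.AlgebraicTopology.SingularHomology
open Literature.AlgebraicGeometry.Motives
open Literature.AlgebraicGeometry.HodgeTheory
open Literature.AlgebraicGeometry.VanGeemen1994

namespace Summit.HodgeConjecture.HodgeConjecture.Theorems.CYFormCarrier

section EquivSU

variable {A : AbelianVariety ℂ} {d : ℕ} {φ : A ⟶ A}
variable (hd : 0 < d) (hA : A.dim = 2 * 4) (hφ : φ ≫ φ = -(d • 𝟙 A))
  (e : ProjectiveEmbedding A.X) {a : complexBetti (projectiveSpace e.n ℂ) 2} (ha : IsRationalClass a)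
  (ha0 : a ≠ 0)

/-! ## §1 Uniqueness: classes of `⋀⁴W^*` (`⋀⁴W`) are determined by their `β`-pairings -/

include hd hA hφ e ha ha0 in
/-- Two classes of `⋀⁴W^*` with the same pairings `β(z, ·)` against `⋀⁴W` are equal. [cite: FriedmanLaza2013, §3.5 Lemma 36] -/
theorem eq_of_beta_eq_right (hSU : HasHodgeGroupSU A φ 4 d (hK d φ e a))
    {y₁ y₂ : complexBetti A.X (2 * 2)} (hy₁ : y₁ ∈ weilClassesMinus A φ 2 d) (hy₂ : y₂ ∈ weilClassesMinus A φ 2 d)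
    (h : ∀ z ∈ weilClassesPlus A φ 2 d,
      topCoord (dim_eq_seven_add_one hA)
        (cupProduct (show 2 * 4 + 2 * 4 = 2 + 2 * 7 from rfl)
          (cupProduct (show 2 * 2 + 2 * 2 = 2 * 4 from rfl) z y₁) (cupPowTwo (hK d φ e a) 4)) =
      topCoord (dim_eq_seven_add_one hA)
        (cupProduct (show 2 * 4 + 2 * 4 = 2 + 2 * 7 from rfl)
          (cupProduct (show 2 * 2 + 2 * 2 = 2 * 4 from rfl) z y₂) (cupPowTwo (hK d φ e a) 4))) :
    y₁ = y₂ := by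
  rw [← sub_eq_zero]
  refine eq_zero_of_beta_eq_zero_right hd hA hφ e ha ha0 hSU (Submodule.sub_mem _ hy₁ hy₂) fun z hz ↦ ?_
  rw [map_sub, LinearMap.map_sub₂, map_sub, h z hz, sub_self]

include hd hA hφ e ha ha0 in
/-- Two classes of `⋀⁴W` with the same pairings `tr((z' ∪ ·) ∪ h_K⁴)` against `⋀⁴W^*` are equal. [cite: FriedmanLaza2013, §3.5 Lemma 36] -/
theorem eq_of_beta'_eq_left (hSU : HasHodgeGroupSU A φ 4 d (hK d φ e a))
    {x₁ x₂ : complexBetti A.X (2 * 2)} (hx₁ : x₁ ∈ weilClassesPlus A φ 2 d) (hx₂ : x₂ ∈ weilClassesPlus A φ 2 d)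
    (h : ∀ z' ∈ weilClassesMinus A φ 2 d,
      topCoord (dim_eq_seven_add_one hA)
        (cupProduct (show 2 * 4 + 2 * 4 = 2 + 2 * 7 from rfl)
          (cupProduct (show 2 * 2 + 2 * 2 = 2 * 4 from rfl) z' x₁) (cupPowTwo (hK d φ e a) 4)) =
      topCoord (dim_eq_seven_add_one hA)
        (cupProduct (show 2 * 4 + 2 * 4 = 2 + 2 * 7 from rfl)
          (cupProduct (show 2 * 2 + 2 * 2 = 2 * 4 from rfl) z' x₂) (cupPowTwo (hK d φ e a) 4))) :
    x₁ = x₂ := by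
  rw [← sub_eq_zero]
  refine eq_zero_of_beta_eq_zero_left hd hA hφ e ha ha0 hSU (Submodule.sub_mem _ hx₁ hx₂) fun y hy ↦ ?_
  rw [cupProduct_comm_four, map_sub, LinearMap.map_sub₂, map_sub, h y hy, sub_self]

/-! ## §2 The exterior action of `SU_H(ℂ)`: bookkeeping -/

/-- `⋀•(id) = id`. [folklore] -/
theorem extAct_id (q : ℕ) : extAct (A := A) (LinearMap.id : complexBetti A.X 1 →ₗ[ℂ] complexBetti A.X 1) q = LinearMap.id := by
  refine exteriorPullback_ext (hasExteriorCohomologyH1 A) fun v ↦ ?_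
  rw [extAct_cupPowOne]
  rfl

/-- `⋀•u (⋀•u⁻¹ x) = x` for an automorphism `u` of `H¹`. [folklore] -/
theorem extAct_apply_symm_apply (u : complexBetti A.X 1 ≃ₗ[ℂ] complexBetti A.X 1) (q : ℕ) (x : complexBetti A.X q) :
    extAct (u : complexBetti A.X 1 →ₗ[ℂ] complexBetti A.X 1) q
      (extAct (u.symm : complexBetti A.X 1 →ₗ[ℂ] complexBetti A.X 1) q x) = x := by
  rw [← LinearMap.comp_apply, ← CYFormSquare.extAct_comp]
  have h : (u : complexBetti A.X 1 →ₗ[ℂ] complexBetti A.X 1) ∘ₗ (u.symm : complexBetti A.X 1 →ₗ[ℂ] complexBetti A.X 1) =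
      LinearMap.id := by
    ext y; simp
  rw [h, extAct_id, LinearMap.id_apply]

/-- In the automorphism group of `H¹`, `u⁻¹ = u.symm`. [folklore] -/
theorem linearEquiv_inv_eq_symm (u : complexBetti A.X 1 ≃ₗ[ℂ] complexBetti A.X 1) : u⁻¹ = u.symm := rfl

include hd hA hφ e ha ha0 in
/-- **`⋀•u` preserves the triple products**: `tr((⋀⁴u z ∪ ⋀⁴u y) ∪ ⋀⁸u p) = tr((z ∪ y) ∪ p)` for `u ∈ SU_H(ℂ)` when `Hg = SU_H`
(`⋀•u` is multiplicative and trivial on `H¹⁶`). [cite: vanGeemen1994HodgeAV, 6.4–6.7] -/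
theorem tri_extAct (hSU : HasHodgeGroupSU A φ 4 d (hK d φ e a))
    {u : complexBetti A.X 1 ≃ₗ[ℂ] complexBetti A.X 1} (hu : u ∈ weilSpecialUnitaryGroup A φ 4 d (hK d φ e a))
    (z y : complexBetti A.X (2 * 2)) (p : complexBetti A.X (2 * 4)) :
    topCoord (dim_eq_seven_add_one hA)
        (cupProduct (show 2 * 4 + 2 * 4 = 2 + 2 * 7 from rfl)
          (cupProduct (show 2 * 2 + 2 * 2 = 2 * 4 from rfl)
            (extAct (u : complexBetti A.X 1 →ₗ[ℂ] complexBetti A.X 1) (2 * 2) z)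
            (extAct (u : complexBetti A.X 1 →ₗ[ℂ] complexBetti A.X 1) (2 * 2) y))
          (extAct (u : complexBetti A.X 1 →ₗ[ℂ] complexBetti A.X 1) (2 * 4) p)) =
      topCoord (dim_eq_seven_add_one hA)
        (cupProduct (show 2 * 4 + 2 * 4 = 2 + 2 * 7 from rfl)
          (cupProduct (show 2 * 2 + 2 * 2 = 2 * 4 from rfl) z y) p) := by
  change topCoord (dim_eq_seven_add_one hA)
      (cupProduct _ (cupProduct _ (exteriorPullback (hasExteriorCohomologyH1 A) _ (2 * 2) z)
        (exteriorPullback (hasExteriorCohomologyH1 A) _ (2 * 2) y))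
        (exteriorPullback (hasExteriorCohomologyH1 A) _ (2 * 4) p)) = _
  rw [← exteriorPullback_cupProduct (hasExteriorCohomologyH1 A) _ (show 2 * 2 + 2 * 2 = 2 * 4 from rfl),
    ← exteriorPullback_cupProduct (hasExteriorCohomologyH1 A) _ (show 2 * 4 + 2 * 4 = 2 + 2 * 7 from rfl)]
  exact congrArg _ (CYFormSquare.extAct_top_eq_self (by omega) hd hA hφ e ha ha0 hSU hu _)

/-- `⋀⁴u` preserves `⋀⁴W` for `u ∈ SU_H(ℂ)`. [cite: vanGeemen1994HodgeAV, Lemma 6.10] -/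
theorem extAct_mem_weilClassesPlus_two {h : complexBetti A.X 2}
    {u : complexBetti A.X 1 ≃ₗ[ℂ] complexBetti A.X 1} (hu : u ∈ weilSpecialUnitaryGroup A φ 4 d h)
    {x : complexBetti A.X (2 * 2)} (hx : x ∈ weilClassesPlus A φ 2 d) :
    extAct (u : complexBetti A.X 1 →ₗ[ℂ] complexBetti A.X 1) (2 * 2) x ∈ weilClassesPlus A φ 2 d :=
  CYFormSquare.extAct_mem_pullbackEigenclasses (fun c ↦ hu.1 c) hx

/-- `⋀⁴u` preserves `⋀⁴W^*` for `u ∈ SU_H(ℂ)`. [cite: vanGeemen1994HodgeAV, Lemma 6.10] -/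
theorem extAct_mem_weilClassesMinus_two {h : complexBetti A.X 2}
    {u : complexBetti A.X 1 ≃ₗ[ℂ] complexBetti A.X 1} (hu : u ∈ weilSpecialUnitaryGroup A φ 4 d h)
    {y : complexBetti A.X (2 * 2)} (hy : y ∈ weilClassesMinus A φ 2 d) :
    extAct (u : complexBetti A.X 1 →ₗ[ℂ] complexBetti A.X 1) (2 * 2) y ∈ weilClassesMinus A φ 2 d :=
  CYFormSquare.extAct_mem_pullbackEigenclasses (fun c ↦ hu.1 c) hy

include hd hA ha ha0 in
/-- `⋀⁸u` fixes `h_K⁴` (`Hg = SU_H` fixes Hodge classes). [cite: vanGeemen1994HodgeAV, 6.6–6.7] -/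
theorem extAct_cupPowTwo_hK_four (hSU : HasHodgeGroupSU A φ 4 d (hK d φ e a))
    {u : complexBetti A.X 1 ≃ₗ[ℂ] complexBetti A.X 1} (hu : u ∈ weilSpecialUnitaryGroup A φ 4 d (hK d φ e a)) :
    extAct (u : complexBetti A.X 1 →ₗ[ℂ] complexBetti A.X 1) (2 * 4) (cupPowTwo (hK d φ e a) 4) = cupPowTwo (hK d φ e a) 4 :=
  extAct_eq_self_of_mem_hodgeClassSpan hSU hu (cupPowTwo_hK_mem_hodgeClassSpan (by omega) hd hA e ha ha0 4)

include hd hA hφ in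
/-- `⋀⁸u` fixes the Weil plane `⋀⁸W ⊕ ⋀⁸W^*` when the Weil classes are Hodge classes (hyperbolic case) and `Hg = SU_H`.
[cite: vanGeemen1994HodgeAV, 4.10, Lemma 5.2 (6) and 6.6–6.7] -/
theorem extAct_eq_self_of_mem_weilClassesOf (hSU : HasHodgeGroupSU A φ 4 d (hK d φ e a))
    (hW : ∀ c ∈ weilClassesOf A φ 4 d, IsOfHodgeType (2 * 4) A.X (2 * 4) 4 4 c)
    {u : complexBetti A.X 1 ≃ₗ[ℂ] complexBetti A.X 1} (hu : u ∈ weilSpecialUnitaryGroup A φ 4 d (hK d φ e a))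
    {v : complexBetti A.X (2 * 4)} (hv : v ∈ weilClassesOf A φ 4 d) :
    extAct (u : complexBetti A.X 1 →ₗ[ℂ] complexBetti A.X 1) (2 * 4) v = v :=
  extAct_eq_self_of_mem_hodgeClassSpan hSU hu (weilClassesOf_le_hodgeClassSpan (by omega) hd hA hφ hW hv)

/-! ## §3 `SU_H(ℂ)`-equivariance of the duality operators -/

include hd hA hφ e ha ha0 in
/-- **`s₊` is `SU_H(ℂ)`-equivariant on `⋀⁴W`**: `s₊(⋀⁴u x) = ⋀⁴u (s₊ x)` for `x ∈ ⋀⁴W`, `u ∈ SU_H(ℂ)`, whenever the datum `v`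
lies in the Weil plane (a Hodge class in the hyperbolic case) and `Hg = SU_H`: both sides lie in `⋀⁴W^*` and have the same
`β`-pairings with every `z = ⋀⁴u z₀ ∈ ⋀⁴W`. [cite: FriedmanLaza2013, §3.5 Lemma 36] [cite: vanGeemen1994HodgeAV, 6.4–6.7 and Thm. 6.12] -/
theorem starPlus_extAct_comm (hSU : HasHodgeGroupSU A φ 4 d (hK d φ e a))
    (hW : ∀ c ∈ weilClassesOf A φ 4 d, IsOfHodgeType (2 * 4) A.X (2 * 4) 4 4 c)
    {v : complexBetti A.X (2 * 4)} (hv : v ∈ weilClassesOf A φ 4 d)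
    (S : complexBetti A.X (2 * 2) →ₗ[ℂ] complexBetti A.X (2 * 2))
    (hS1 : ∀ x ∈ weilClassesPlus A φ 2 d, S x ∈ weilClassesMinus A φ 2 d)
    (hS2 : ∀ x ∈ weilClassesPlus A φ 2 d, ∀ z ∈ weilClassesPlus A φ 2 d,
      topCoord (dim_eq_seven_add_one hA)
          (cupProduct (show 2 * 4 + 2 * 4 = 2 + 2 * 7 from rfl)
            (cupProduct (show 2 * 2 + 2 * 2 = 2 * 4 from rfl) z (S x)) (cupPowTwo (hK d φ e a) 4)) =
        topCoord (dim_eq_seven_add_one hA)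
          (cupProduct (show 2 * 4 + 2 * 4 = 2 + 2 * 7 from rfl)
            (cupProduct (show 2 * 2 + 2 * 2 = 2 * 4 from rfl) z x) v))
    {u : complexBetti A.X 1 ≃ₗ[ℂ] complexBetti A.X 1} (hu : u ∈ weilSpecialUnitaryGroup A φ 4 d (hK d φ e a))
    {x : complexBetti A.X (2 * 2)} (hx : x ∈ weilClassesPlus A φ 2 d) :
    S (extAct (u : complexBetti A.X 1 →ₗ[ℂ] complexBetti A.X 1) (2 * 2) x) =
      extAct (u : complexBetti A.X 1 →ₗ[ℂ] complexBetti A.X 1) (2 * 2) (S x) := by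
  have hu' : u.symm ∈ weilSpecialUnitaryGroup A φ 4 d (hK d φ e a) := by
    rw [← linearEquiv_inv_eq_symm]; exact inv_mem hu
  have hUx : extAct (u : complexBetti A.X 1 →ₗ[ℂ] complexBetti A.X 1) (2 * 2) x ∈ weilClassesPlus A φ 2 d :=
    extAct_mem_weilClassesPlus_two hu hx
  refine eq_of_beta_eq_right hd hA hφ e ha ha0 hSU (hS1 _ hUx) (extAct_mem_weilClassesMinus_two hu (hS1 x hx)) fun z hz ↦ ?_
  -- `z = ⋀⁴u z₀`
  set z₀ := extAct (u.symm : complexBetti A.X 1 →ₗ[ℂ] complexBetti A.X 1) (2 * 2) z with hz₀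
  have hz₀P : z₀ ∈ weilClassesPlus A φ 2 d := extAct_mem_weilClassesPlus_two hu' hz
  have hzz : z = extAct (u : complexBetti A.X 1 →ₗ[ℂ] complexBetti A.X 1) (2 * 2) z₀ := (extAct_apply_symm_apply u (2 * 2) z).symm
  rw [hzz, hS2 _ hUx _ (extAct_mem_weilClassesPlus_two hu hz₀P)]
  conv_lhs => rw [← extAct_eq_self_of_mem_weilClassesOf hd hA hφ e hSU hW hu hv]
  conv_rhs => rw [← extAct_cupPowTwo_hK_four hd hA e ha ha0 hSU hu]
  rw [tri_extAct hd hA hφ e ha ha0 hSU hu, tri_extAct hd hA hφ e ha ha0 hSU hu, hS2 x hx z₀ hz₀P]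

include hd hA hφ e ha ha0 in
/-- **`s₋` is `SU_H(ℂ)`-equivariant on `⋀⁴W^*`**: `s₋(⋀⁴u y) = ⋀⁴u (s₋ y)` for `y ∈ ⋀⁴W^*`, `u ∈ SU_H(ℂ)`.
[cite: FriedmanLaza2013, §3.5 Lemma 36] [cite: vanGeemen1994HodgeAV, 6.4–6.7 and Thm. 6.12] -/
theorem starMinus_extAct_comm (hSU : HasHodgeGroupSU A φ 4 d (hK d φ e a))
    (hW : ∀ c ∈ weilClassesOf A φ 4 d, IsOfHodgeType (2 * 4) A.X (2 * 4) 4 4 c)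
    {v' : complexBetti A.X (2 * 4)} (hv' : v' ∈ weilClassesOf A φ 4 d)
    (S' : complexBetti A.X (2 * 2) →ₗ[ℂ] complexBetti A.X (2 * 2))
    (hS1 : ∀ y ∈ weilClassesMinus A φ 2 d, S' y ∈ weilClassesPlus A φ 2 d)
    (hS2 : ∀ y ∈ weilClassesMinus A φ 2 d, ∀ z' ∈ weilClassesMinus A φ 2 d,
      topCoord (dim_eq_seven_add_one hA)
          (cupProduct (show 2 * 4 + 2 * 4 = 2 + 2 * 7 from rfl)
            (cupProduct (show 2 * 2 + 2 * 2 = 2 * 4 from rfl) z' (S' y)) (cupPowTwo (hK d φ e a) 4)) =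
        topCoord (dim_eq_seven_add_one hA)
          (cupProduct (show 2 * 4 + 2 * 4 = 2 + 2 * 7 from rfl)
            (cupProduct (show 2 * 2 + 2 * 2 = 2 * 4 from rfl) z' y) v'))
    {u : complexBetti A.X 1 ≃ₗ[ℂ] complexBetti A.X 1} (hu : u ∈ weilSpecialUnitaryGroup A φ 4 d (hK d φ e a))
    {y : complexBetti A.X (2 * 2)} (hy : y ∈ weilClassesMinus A φ 2 d) :
    S' (extAct (u : complexBetti A.X 1 →ₗ[ℂ] complexBetti A.X 1) (2 * 2) y) =
      extAct (u : complexBetti A.X 1 →ₗ[ℂ] complexBetti A.X 1) (2 * 2) (S' y) := by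
  have hu' : u.symm ∈ weilSpecialUnitaryGroup A φ 4 d (hK d φ e a) := by
    rw [← linearEquiv_inv_eq_symm]; exact inv_mem hu
  have hUy : extAct (u : complexBetti A.X 1 →ₗ[ℂ] complexBetti A.X 1) (2 * 2) y ∈ weilClassesMinus A φ 2 d :=
    extAct_mem_weilClassesMinus_two hu hy
  refine eq_of_beta'_eq_left hd hA hφ e ha ha0 hSU (hS1 _ hUy) (extAct_mem_weilClassesPlus_two hu (hS1 y hy)) fun z' hz' ↦ ?_
  set z₀ := extAct (u.symm : complexBetti A.X 1 →ₗ[ℂ] complexBetti A.X 1) (2 * 2) z' with hz₀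
  have hz₀M : z₀ ∈ weilClassesMinus A φ 2 d := extAct_mem_weilClassesMinus_two hu' hz'
  have hzz : z' = extAct (u : complexBetti A.X 1 →ₗ[ℂ] complexBetti A.X 1) (2 * 2) z₀ :=
    (extAct_apply_symm_apply u (2 * 2) z').symm
  rw [hzz, hS2 _ hUy _ (extAct_mem_weilClassesMinus_two hu hz₀M)]
  conv_lhs => rw [← extAct_eq_self_of_mem_weilClassesOf hd hA hφ e hSU hW hu hv']
  conv_rhs => rw [← extAct_cupPowTwo_hK_four hd hA e ha ha0 hSU hu]
  rw [tri_extAct hd hA hφ e ha ha0 hSU hu, tri_extAct hd hA hφ e ha ha0 hSU hu, hS2 y hy z₀ hz₀M]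

end EquivSU

end Summit.HodgeConjecture.HodgeConjecture.Theorems.CYFormCarrier

end
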